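import Summits.FinalStateConjecture.FinalStateConjecture.Theorems.EIHFluxBalanceInertialRecessionStubHigherOrderHoleCore

/-!
# Route EIHFluxBalance — `InertialRecession` (E′), line `SketchCleanExcision`, skeleton r13,
# stub `stub_higherOrderSlaving` (EF): the per-hole package — sizes of the frame, body-rate and
# centre data in terms of the visible jets, and the dictionary back

Helper file for the crux `stmt-FinalStateConjecture-17403`
(`Summit.FinalStateConjecture.FinalStateConjecture.Theses.EIHFluxBalance.InertialRecession`, E′),
registered stub `stub_higherOrderSlaving` (orders two and three of frozen-vacuum slaving).

For one painted hole (smooth `Λ`, `ξ`, spin `a`, Lorentz factor `≤ γ`) `higherOrder_holePackage`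
chooses the representative frame `Λ̃` of `…StubHigherOrderHoleFrame` and bounds, at every base time
`t` and with ONE constant `Q`, the inputs of the variation bounds (`…StubHigherOrderVariation`) —
`‖Λ̃‖, ‖Λ̃⁻¹‖ ≤ Q`, `q₁ ≤ Q E₁`, `q₂ ≤ Q (E₂ + E₁)`, `q₃ ≤ Q (E₃ + E₂ + E₁)`, `‖A‖ ≤ Q E₁`,
`‖A′‖ ≤ Q (E₂ + E₁)` — by the VISIBLE sizes `E_k = ‖u⁽ᵏ⁾‖ + ‖μ⁽ᵏ⁻¹⁾‖ + 𝟙[a ≠ 0]‖n⁽ᵏ⁾‖`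
(`u = Λe₀`, `n = Λe₃`, `μ = ξ′ − ũ/u⁰` the velocity mismatch), and conversely the DICTIONARY
`E₂ ≤ Q (red₂ + E₁)`, `E₃ ≤ Q (red₃ + E₂ + E₁)` for the reduced sizes
`red_k = ‖A⁽ᵏ⁻¹⁾e₀‖ + ‖(Λ̃⁻¹(−c̃⁽ᵏ⁾))~‖ + ‖a • A⁽ᵏ⁻¹⁾e₃‖` that the coercivity statement
`stub_coerSymbolQuant` controls (body-rate identities of `…StubHigherOrderBodyRates`, boosts stretch
spatial vectors). The smallness provisos `E₁ ≤ 1`, `E₂ ≤ 1` are supplied by first-order slaving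
resp. by the second-order step.

No definitions, no named facts, no `sorry`.
-/

set_option linter.dupNamespace false
set_option maxSynthPendingDepth 6
set_option synthInstance.maxHeartbeats 200000

noncomputable section

namespace Summit.FinalStateConjecture.FinalStateConjecture.Theorems.SublinearIsFree.Slaving

open scoped Topology ContDiff
open Filter Set Function Metric Literature.Geometry.Lorentzian
  Summit.FinalStateConjecture.FinalStateConjecture.Theorems

set_option maxHeartbeats 6400000 in
/-- **The per-hole package.** See the module docstring. [folklore] -/
theorem higherOrder_holePackage (Λ : ℝ → lorentzGroup) (ξ : ℝ → E3) (a : ℝ) {γ : ℝ}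
    (hΛ : ContDiff ℝ ∞ (fun t ↦ ((Λ t : E4 ≃L[ℝ] E4) : E4 →L[ℝ] E4))) (hξ : ContDiff ℝ ∞ ξ)
    (hγ : ∀ t, |((Λ t : E4 ≃L[ℝ] E4) (E4.basisVector 0)) 0| ≤ γ) :
    ∃ (Λ' : ℝ → lorentzGroup) (Q : ℝ), 1 ≤ Q ∧
      ContDiff ℝ ∞ (fun t ↦ ((Λ' t : E4 ≃L[ℝ] E4) : E4 →L[ℝ] E4)) ∧
      (∀ t c M z, boostedKerrBilin (Λ' t) c M a z = boostedKerrBilin (Λ t) c M a z) ∧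
      (∀ t, (Λ' t : E4 ≃L[ℝ] E4) (E4.basisVector 0) = (Λ t : E4 ≃L[ℝ] E4) (E4.basisVector 0)) ∧
      (a ≠ 0 → ∀ t, (Λ' t : E4 ≃L[ℝ] E4) (E4.basisVector 3) = (Λ t : E4 ≃L[ℝ] E4) (E4.basisVector 3)) ∧
      (∀ t, |((Λ' t : E4 ≃L[ℝ] E4) (E4.basisVector 0)) 0| ≤ γ) ∧
      ∀ t : ℝ,
        let F : ℝ → E4 →L[ℝ] E4 := fun s ↦ ((Λ' s : E4 ≃L[ℝ] E4) : E4 →L[ℝ] E4)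
        let S : ℝ → E4 →L[ℝ] E4 := fun s ↦ (((Λ' s : E4 ≃L[ℝ] E4).symm : E4 ≃L[ℝ] E4) : E4 →L[ℝ] E4)
        let A : ℝ → E4 →L[ℝ] E4 := fun s ↦ (deriv S s).comp (F s)
        let u : ℝ → E4 := fun s ↦ (Λ s : E4 ≃L[ℝ] E4) (E4.basisVector 0)
        let n : ℝ → E4 := fun s ↦ (Λ s : E4 ≃L[ℝ] E4) (E4.basisVector 3)
        let μ : ℝ → E3 := fun s ↦ deriv ξ s - ((u s) 0)⁻¹ • E4.spatial (u s)
        let cc : ℝ → E4 := fun s ↦ E4.ofTimeSpace s (ξ s) - ((s - t) * (u t 0)⁻¹) • u s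
        let E₁ : ℝ := ‖deriv u t‖ + ‖μ t‖ + (if a = 0 then 0 else ‖deriv n t‖)
        let E₂ : ℝ := ‖iteratedDeriv 2 u t‖ + ‖deriv μ t‖ + (if a = 0 then 0 else ‖iteratedDeriv 2 n t‖)
        let E₃ : ℝ := ‖iteratedDeriv 3 u t‖ + ‖iteratedDeriv 2 μ t‖ +
          (if a = 0 then 0 else ‖iteratedDeriv 3 n t‖)
        ‖F t‖ ≤ Q ∧ ‖S t‖ ≤ Q ∧
        (ContDiff ℝ ∞ cc ∧ cc t = E4.ofTimeSpace t (ξ t) ∧ deriv cc t = E4.spaceEmbed (μ t) ∧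
          ∀ (M s : ℝ) (z : E4), boostedKerrBilin (Λ s) (E4.ofTimeSpace s (ξ s)) M a z =
            boostedKerrBilin (Λ' s) (cc s) M a z) ∧
        ‖deriv S t‖ + ‖deriv cc t‖ ≤ Q * E₁ ∧
        (E₁ ≤ 1 → ‖iteratedDeriv 2 S t‖ + ‖iteratedDeriv 2 cc t‖ ≤ Q * (E₂ + E₁)) ∧
        (E₁ ≤ 1 → E₂ ≤ 1 → ‖iteratedDeriv 3 S t‖ + ‖iteratedDeriv 3 cc t‖ ≤ Q * (E₃ + E₂ + E₁)) ∧
        ‖A t‖ ≤ Q * E₁ ∧ (E₁ ≤ 1 → ‖deriv A t‖ ≤ Q * (E₂ + E₁)) ∧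
        (E₁ ≤ 1 → E₂ ≤ Q * ((‖deriv A t (E4.basisVector 0)‖ +
          ‖E4.spatial (S t (-(iteratedDeriv 2 cc t)))‖ + ‖a • deriv A t (E4.basisVector 3)‖) + E₁)) ∧
        (E₁ ≤ 1 → E₂ ≤ 1 → E₃ ≤ Q * ((‖iteratedDeriv 2 A t (E4.basisVector 0)‖ +
          ‖E4.spatial (S t (-(iteratedDeriv 3 cc t)))‖ + ‖a • iteratedDeriv 2 A t (E4.basisVector 3)‖) +
            E₂ + E₁)) := by
  -- the representative frame, the core bounds and the constants
  obtain ⟨Λ', K, hK0, hΛ's, hpaint, hcol, hcol3, hγ', hbd⟩ := higherOrder_exists_holeFrame Λ a hΛ hγ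
  obtain ⟨B, hB1, hcore⟩ := higherOrder_holeCore Λ Λ' ξ a hΛ hξ hγ hΛ's hpaint hcol hcol3 hγ' hbd
  have hB0 : 0 ≤ B := zero_le_one.trans hB1
  set P : ℝ := B ^ 10 with hPdef
  have hP1 : 1 ≤ P := one_le_pow₀ hB1
  have hP0 : 0 ≤ P := zero_le_one.trans hP1
  have hBP : ∀ k ≤ 10, B ^ k ≤ P := fun k hk ↦ pow_le_pow_right₀ hB1 hk
  have hBP1 : B ≤ P := by have := hBP 1 (by norm_num); rwa [pow_one] at this
  set Ba : ℝ := if a = 0 then 1 else max 1 |a|⁻¹ with hBadef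
  have hBa1 : 1 ≤ Ba := by rw [hBadef]; split_ifs <;> simp
  have hBa0 : 0 ≤ Ba := zero_le_one.trans hBa1
  set Q : ℝ := 30 * P * Ba with hQdef
  have hPQ : P ≤ Q := by
    rw [hQdef]
    have h := mul_le_mul hP1 hBa1 zero_le_one hP0
    nlinarith only [h, hP0, hBa1]
  have hQ1 : 1 ≤ Q := hP1.trans hPQ
  have hQ0 : 0 ≤ Q := zero_le_one.trans hQ1
  refine ⟨Λ', Q, hQ1, hΛ's, hpaint, hcol, hcol3, hγ', fun t ↦ ?_⟩
  intro F S A u n μ cc E₁ E₂ E₃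
  obtain ⟨hFB, hSB, s₁, s₂, s₃, hA0, hA1, hccfacts, hcc1, hcc2, hcc3, hμ1, hμ2, ⟨hu2low, hu3low⟩, hncol⟩ := hcore t
  have hE₁0 : 0 ≤ E₁ := by positivity
  have hE₂0 : 0 ≤ E₂ := by positivity
  have hE₃0 : 0 ≤ E₃ := by positivity
  have hμ₁E : ‖deriv μ t‖ ≤ E₂ := by
    show _ ≤ ‖iteratedDeriv 2 u t‖ + ‖deriv μ t‖ + (if a = 0 then 0 else ‖iteratedDeriv 2 n t‖)
    have h1 := norm_nonneg (iteratedDeriv 2 u t)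
    have h2 : 0 ≤ (if a = 0 then 0 else ‖iteratedDeriv 2 n t‖) := by split_ifs <;> positivity
    linarith only [h1, h2]
  have hμ₂E : ‖iteratedDeriv 2 μ t‖ ≤ E₃ := by
    show _ ≤ ‖iteratedDeriv 3 u t‖ + ‖iteratedDeriv 2 μ t‖ + (if a = 0 then 0 else ‖iteratedDeriv 3 n t‖)
    have h1 := norm_nonneg (iteratedDeriv 3 u t)
    have h2 : 0 ≤ (if a = 0 then 0 else ‖iteratedDeriv 3 n t‖) := by split_ifs <;> positivity
    linarith only [h1, h2]
  -- monomial bookkeeping: `c Bᵏ ≤ Q` and `c Bᵏ Ba ≤ Q` for `c ≤ 30`, `k ≤ 10`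
  have hmono : ∀ (c : ℝ) (k : ℕ), 0 ≤ c → c ≤ 30 → k ≤ 10 → c * B ^ k * Ba ≤ Q := by
    intro c k hc0 hc hk
    rw [hQdef]
    exact mul_le_mul_of_nonneg_right (mul_le_mul hc (hBP k hk) (by positivity) (by norm_num)) hBa0
  have hmono' : ∀ (c : ℝ) (k : ℕ), 0 ≤ c → c ≤ 30 → k ≤ 10 → c * B ^ k ≤ Q := fun c k hc0 hc hk ↦ by
    have h := hmono c k hc0 hc hk
    exact (le_mul_of_one_le_right (by positivity) hBa1).trans h
  -- final assembly of the nine bounds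
  refine ⟨hFB.trans hBP1 |>.trans hPQ, hSB.trans hBP1 |>.trans hPQ, hccfacts,
    ?_, ?_, ?_, ?_, ?_, ?_, ?_⟩
  · -- `q₁`
    calc ‖deriv S t‖ + ‖deriv cc t‖ ≤ B ^ 2 * E₁ + E₁ := add_le_add s₁ hcc1
      _ = (B ^ 2 + 1) * E₁ := by ring
      _ ≤ Q * E₁ := by
          refine mul_le_mul_of_nonneg_right ?_ hE₁0
          have h := hmono' 2 2 (by norm_num) (by norm_num) (by norm_num)
          have h1 : (1 : ℝ) ≤ B ^ 2 := one_le_pow₀ hB1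
          linarith only [h, h1]
  · -- `q₂`
    intro h1
    calc ‖iteratedDeriv 2 S t‖ + ‖iteratedDeriv 2 cc t‖
        ≤ 2 * B ^ 3 * (E₂ + E₁) + (‖deriv μ t‖ + B * E₁ + 2 * E₁) := add_le_add (s₂ h1) hcc2
      _ ≤ 2 * B ^ 3 * (E₂ + E₁) + (E₂ + B * E₁ + 2 * E₁) := by gcongr
      _ ≤ (2 * B ^ 3 + B + 2) * (E₂ + E₁) := by
          have hBE : 0 ≤ B * E₂ := mul_nonneg hB0 hE₂0
          nlinarith only [hBE, hE₂0, hE₁0]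
      _ ≤ Q * (E₂ + E₁) := by
          refine mul_le_mul_of_nonneg_right ?_ (by positivity)
          have h := hmono' 5 3 (by norm_num) (by norm_num) (by norm_num)
          have h1 : (1 : ℝ) ≤ B ^ 3 := one_le_pow₀ hB1
          have h2 : B ≤ B ^ 3 := le_self_pow₀ hB1 (by norm_num)
          linarith only [h, h1, h2]
  · -- `q₃`
    intro h1 h2
    calc ‖iteratedDeriv 3 S t‖ + ‖iteratedDeriv 3 cc t‖
        ≤ 5 * B ^ 4 * (E₃ + E₂ + E₁) + (‖iteratedDeriv 2 μ t‖ + B * (E₂ + E₁ ^ 2) + 3 * E₂) :=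
          add_le_add (s₃ h1 h2) hcc3
      _ ≤ 5 * B ^ 4 * (E₃ + E₂ + E₁) + (E₃ + B * (E₂ + E₁) + 3 * E₂) := by
          have hx : E₁ ^ 2 ≤ E₁ := pow_le_of_le_one hE₁0 h1 two_ne_zero
          gcongr
      _ ≤ (5 * B ^ 4 + B + 4) * (E₃ + E₂ + E₁) := by
          have h1 : 0 ≤ B * E₃ := mul_nonneg hB0 hE₃0
          nlinarith only [h1, hE₃0, hE₂0, hE₁0]
      _ ≤ Q * (E₃ + E₂ + E₁) := by
          refine mul_le_mul_of_nonneg_right ?_ (by positivity)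
          have h := hmono' 10 4 (by norm_num) (by norm_num) (by norm_num)
          have h1 : (1 : ℝ) ≤ B ^ 4 := one_le_pow₀ hB1
          have h2 : B ≤ B ^ 4 := le_self_pow₀ hB1 (by norm_num)
          linarith only [h, h1, h2]
  · -- `‖A‖`
    refine hA0.trans (mul_le_mul_of_nonneg_right ?_ hE₁0)
    have h := hmono' 1 3 (by norm_num) (by norm_num) (by norm_num); linarith only [h]
  · -- `‖A′‖`
    intro h1
    refine (hA1 h1).trans (mul_le_mul_of_nonneg_right ?_ (by positivity))
    exact hmono' 3 4 (by norm_num) (by norm_num) (by norm_num)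
  · -- the dictionary, order two
    intro h1
    have hA2 : ‖A t‖ ^ 2 ≤ B ^ 6 * E₁ := by
      calc ‖A t‖ ^ 2 ≤ (B ^ 3 * E₁) ^ 2 := pow_le_pow_left₀ (norm_nonneg _) hA0 2
        _ = B ^ 6 * (E₁ * E₁) := by ring
        _ ≤ B ^ 6 * E₁ := by gcongr; exact mul_le_of_le_one_left hE₁0 h1
    have hn2 : (if a = 0 then 0 else ‖iteratedDeriv 2 n t‖) ≤
        B * Ba * ‖a • deriv A t (E4.basisVector 3)‖ + B ^ 7 * E₁ := by
      split_ifs with ha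
      · positivity
      · obtain ⟨hn2low, -⟩ := hncol ha
        have haBa : ‖deriv A t (E4.basisVector 3)‖ ≤ Ba * ‖a • deriv A t (E4.basisVector 3)‖ := by
          rw [norm_smul, Real.norm_eq_abs, hBadef, if_neg ha]
          have ha0 : 0 < |a| := abs_pos.2 ha
          calc ‖deriv A t (E4.basisVector 3)‖ = |a|⁻¹ * (|a| * ‖deriv A t (E4.basisVector 3)‖) := by
                field_simp
            _ ≤ max 1 |a|⁻¹ * (|a| * ‖deriv A t (E4.basisVector 3)‖) :=
                mul_le_mul_of_nonneg_right (le_max_right _ _) (by positivity)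
        calc _ ≤ B * (‖deriv A t (E4.basisVector 3)‖ + ‖A t‖ ^ 2) := hn2low
          _ ≤ B * (Ba * ‖a • deriv A t (E4.basisVector 3)‖ + B ^ 6 * E₁) := by gcongr
          _ = _ := by ring
    have hu2 : ‖iteratedDeriv 2 u t‖ ≤ B * ‖deriv A t (E4.basisVector 0)‖ + B ^ 7 * E₁ := by
      calc _ ≤ B * (‖deriv A t (E4.basisVector 0)‖ + ‖A t‖ ^ 2) := hu2low
        _ ≤ B * (‖deriv A t (E4.basisVector 0)‖ + B ^ 6 * E₁) := by gcongr
        _ = _ := by ring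
    have hBBa : B * Ba ≤ Q := by
      have h := hmono 1 1 (by norm_num) (by norm_num) (by norm_num); rwa [one_mul, pow_one] at h
    have hB7 : 2 * B ^ 7 + 3 * B ≤ Q := by
      have h1' := hmono' 5 7 (by norm_num) (by norm_num) (by norm_num)
      have h2 : B ≤ B ^ 7 := le_self_pow₀ hB1 (by norm_num)
      linarith only [h1', h2]
    have hBQ : B ≤ Q := hBP1.trans hPQ
    show ‖iteratedDeriv 2 u t‖ + ‖deriv μ t‖ + (if a = 0 then 0 else ‖iteratedDeriv 2 n t‖) ≤ _
    have hsp0 := norm_nonneg (E4.spatial (S t (-(iteratedDeriv 2 cc t))))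
    have hr0 := norm_nonneg (deriv A t (E4.basisVector 0))
    have hr3 := norm_nonneg (a • deriv A t (E4.basisVector 3))
    have k1 := mul_le_mul_of_nonneg_right hBBa hr3
    have k2 := mul_le_mul_of_nonneg_right hBQ hr0
    have k3 := mul_le_mul_of_nonneg_right hB7 hE₁0
    have k4 := mul_le_mul_of_nonneg_right hQ1 hsp0
    have e1 : (2 * B ^ 7 + 3 * B) * E₁ = B ^ 7 * E₁ + B ^ 7 * E₁ + 2 * (B * E₁) + B * E₁ := by ring
    have e2 : B * Ba * ‖a • deriv A t (E4.basisVector 3)‖ = (B * Ba) * ‖a • deriv A t (E4.basisVector 3)‖ := rfl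
    rw [e1] at k3
    linarith only [hu2, hμ1, hn2, k1, k2, k3, k4]
  · -- the dictionary, order three
    intro h1 h2
    have hμ2 := hμ2 h1
    have hgarb : 3 * ‖deriv A t‖ * ‖A t‖ + ‖A t‖ ^ 3 ≤ 10 * B ^ 9 * (E₂ + E₁) := by
      have hA0' := hA0
      have hA1' := hA1 h1
      calc _ ≤ 3 * (3 * B ^ 4 * (E₂ + E₁)) * (B ^ 3 * E₁) + (B ^ 3 * E₁) ^ 3 := by gcongr
        _ = 9 * B ^ 7 * ((E₂ + E₁) * E₁) + B ^ 9 * (E₁ ^ 2 * E₁) := by ring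
        _ ≤ 9 * B ^ 7 * (E₂ + E₁) + B ^ 9 * E₁ := by
            gcongr
            · exact mul_le_of_le_one_right (by positivity) h1
            · exact mul_le_of_le_one_left hE₁0 (pow_le_one₀ hE₁0 h1)
        _ ≤ 10 * B ^ 9 * (E₂ + E₁) := by
            have h79 : B ^ 7 ≤ B ^ 9 := pow_le_pow_right₀ hB1 (by norm_num)
            have k := mul_le_mul_of_nonneg_right h79 (by positivity : (0 : ℝ) ≤ E₂ + E₁)
            have k2 : 0 ≤ B ^ 9 * E₂ := mul_nonneg (pow_nonneg hB0 9) hE₂0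
            nlinarith only [k, k2]
    have hn3 : (if a = 0 then 0 else ‖iteratedDeriv 3 n t‖) ≤
        B * Ba * ‖a • iteratedDeriv 2 A t (E4.basisVector 3)‖ + 10 * B ^ 10 * (E₂ + E₁) := by
      split_ifs with ha
      · positivity
      · obtain ⟨-, hn3low⟩ := hncol ha
        have haBa : ‖iteratedDeriv 2 A t (E4.basisVector 3)‖ ≤ Ba * ‖a • iteratedDeriv 2 A t (E4.basisVector 3)‖ := by
          rw [norm_smul, Real.norm_eq_abs, hBadef, if_neg ha]
          have ha0 : 0 < |a| := abs_pos.2 ha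
          calc ‖iteratedDeriv 2 A t (E4.basisVector 3)‖ = |a|⁻¹ * (|a| * ‖iteratedDeriv 2 A t (E4.basisVector 3)‖) := by
                field_simp
            _ ≤ max 1 |a|⁻¹ * (|a| * ‖iteratedDeriv 2 A t (E4.basisVector 3)‖) :=
                mul_le_mul_of_nonneg_right (le_max_right _ _) (by positivity)
        calc _ ≤ B * (‖iteratedDeriv 2 A t (E4.basisVector 3)‖ + 3 * ‖deriv A t‖ * ‖A t‖ + ‖A t‖ ^ 3) := hn3low
          _ = B * ‖iteratedDeriv 2 A t (E4.basisVector 3)‖ + B * (3 * ‖deriv A t‖ * ‖A t‖ + ‖A t‖ ^ 3) := by ring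
          _ ≤ B * (Ba * ‖a • iteratedDeriv 2 A t (E4.basisVector 3)‖) + B * (10 * B ^ 9 * (E₂ + E₁)) := by gcongr
          _ = _ := by ring
    have hu3 : ‖iteratedDeriv 3 u t‖ ≤ B * ‖iteratedDeriv 2 A t (E4.basisVector 0)‖ + 10 * B ^ 10 * (E₂ + E₁) := by
      calc _ ≤ B * (‖iteratedDeriv 2 A t (E4.basisVector 0)‖ + 3 * ‖deriv A t‖ * ‖A t‖ + ‖A t‖ ^ 3) := hu3low
        _ = B * ‖iteratedDeriv 2 A t (E4.basisVector 0)‖ + B * (3 * ‖deriv A t‖ * ‖A t‖ + ‖A t‖ ^ 3) := by ring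
        _ ≤ B * ‖iteratedDeriv 2 A t (E4.basisVector 0)‖ + B * (10 * B ^ 9 * (E₂ + E₁)) := by gcongr
        _ = _ := by ring
    have hBBa : B * Ba ≤ Q := by
      have h := hmono 1 1 (by norm_num) (by norm_num) (by norm_num); rwa [one_mul, pow_one] at h
    have hB10 : 20 * B ^ 10 + 5 * B ≤ Q := by
      have h1' := hmono' 25 10 (by norm_num) (by norm_num) (by norm_num)
      have h2 : B ≤ B ^ 10 := le_self_pow₀ hB1 (by norm_num)
      linarith only [h1', h2]
    have hBQ : B ≤ Q := hBP1.trans hPQ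
    show ‖iteratedDeriv 3 u t‖ + ‖iteratedDeriv 2 μ t‖ + (if a = 0 then 0 else ‖iteratedDeriv 3 n t‖) ≤ _
    have hsp0 := norm_nonneg (E4.spatial (S t (-(iteratedDeriv 3 cc t))))
    have hr0 := norm_nonneg (iteratedDeriv 2 A t (E4.basisVector 0))
    have hr3 := norm_nonneg (a • iteratedDeriv 2 A t (E4.basisVector 3))
    have k1 := mul_le_mul_of_nonneg_right hBBa hr3
    have k2 := mul_le_mul_of_nonneg_right hBQ hr0
    have k3 := mul_le_mul_of_nonneg_right hB10 (add_nonneg hE₂0 hE₁0)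
    have k4 := mul_le_mul_of_nonneg_right hQ1 hsp0
    have e1 : (20 * B ^ 10 + 5 * B) * (E₂ + E₁) =
        10 * B ^ 10 * (E₂ + E₁) + 10 * B ^ 10 * (E₂ + E₁) + 3 * (B * E₂) + B * (E₂ + E₁) + B * E₂ +
          4 * (B * E₁) := by ring
    rw [e1] at k3
    have k5 : 0 ≤ B * E₁ := mul_nonneg hB0 hE₁0
    have k6 : 0 ≤ B * E₂ := mul_nonneg hB0 hE₂0
    have e3 : B * (E₂ + E₁) = B * E₂ + B * E₁ := by ring
    rw [e3] at k3 hμ2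
    linarith only [hu3, hμ2, hn3, k1, k2, k3, k4, k5, k6]

/-- **Registered one-line carrier form** (`higherOrder_holePackage3_EF`) of `higherOrder_holePackage`.
[folklore] -/
theorem higherOrder_holePackage3_EF : open Literature.Geometry.Lorentzian in ∀ (Λ : ℝ → lorentzGroup) (ξ : ℝ → E3) (a : ℝ) {γ : ℝ}, ContDiff ℝ ((⊤ : ℕ∞) : WithTop ℕ∞) (fun t ↦ ((Λ t : E4 ≃L[ℝ] E4) : E4 →L[ℝ] E4)) → ContDiff ℝ ((⊤ : ℕ∞) : WithTop ℕ∞) ξ → (∀ t, |((Λ t : E4 ≃L[ℝ] E4) (E4.basisVector 0)) 0| ≤ γ) → ∃ (Λ' : ℝ → lorentzGroup) (Q : ℝ), 1 ≤ Q ∧ ContDiff ℝ ((⊤ : ℕ∞) : WithTop ℕ∞) (fun t ↦ ((Λ' t : E4 ≃L[ℝ] E4) : E4 →L[ℝ] E4)) ∧ (∀ t c M z, boostedKerrBilin (Λ' t) c M a z = boostedKerrBilin (Λ t) c M a z) ∧ (∀ t, (Λ' t : E4 ≃L[ℝ] E4) (E4.basisVector 0) = (Λ t : E4 ≃L[ℝ]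 E4) (E4.basisVector 0)) ∧ (a ≠ 0 → ∀ t, (Λ' t : E4 ≃L[ℝ] E4) (E4.basisVector 3) = (Λ t : E4 ≃L[ℝ] E4) (E4.basisVector 3)) ∧ (∀ t, |((Λ' t : E4 ≃L[ℝ] E4) (E4.basisVector 0)) 0| ≤ γ) ∧ ∀ t : ℝ, let F : ℝ → E4 →L[ℝ] E4 := fun s ↦ ((Λ' s : E4 ≃L[ℝ] E4) : E4 →L[ℝ] E4); let S : ℝ → E4 →L[ℝ] E4 := fun s ↦ (((Λ' s : E4 ≃L[ℝ] E4).symm : E4 ≃L[ℝ] E4) : E4 →L[ℝ] E4); let A : ℝ → E4 →L[ℝ] E4 := fun s ↦ (deriv S s).comp (F s); let u : ℝ → E4 := fun s ↦ (Λ s : E4 ≃L[ℝ] E4) (E4.basisVector 0); let n : ℝ → E4 := fun s ↦ (Λ s : E4 ≃L[ℝ] E4) (E4.basisVector 3); let μ : ℝ → E3 := fun s ↦ deriv ξ s - ((u s) 0)⁻¹ • E4.spatial (u s); let cc : ℝ → E4 := fun s ↦ E4.ofTimeSpace s (ξ s) - ((s - t) * (u t 0)⁻¹) • u s; let E₁ :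 ℝ := ‖deriv u t‖ + ‖μ t‖ + (if a = 0 then 0 else ‖deriv n t‖); let E₂ : ℝ := ‖iteratedDeriv 2 u t‖ + ‖deriv μ t‖ + (if a = 0 then 0 else ‖iteratedDeriv 2 n t‖); let E₃ : ℝ := ‖iteratedDeriv 3 u t‖ + ‖iteratedDeriv 2 μ t‖ + (if a = 0 then 0 else ‖iteratedDeriv 3 n t‖); ‖F t‖ ≤ Q ∧ ‖S t‖ ≤ Q ∧ (ContDiff ℝ ((⊤ : ℕ∞) : WithTop ℕ∞) cc ∧ cc t = E4.ofTimeSpace t (ξ t) ∧ deriv cc t = E4.spaceEmbed (μ t) ∧ ∀ (M s : ℝ) (z : E4), boostedKerrBilin (Λ s) (E4.ofTimeSpace s (ξ s)) M a z = boostedKerrBilin (Λ' s) (cc s) M a z) ∧ ‖deriv S t‖ + ‖deriv cc t‖ ≤ Q * E₁ ∧ (E₁ ≤ 1 → ‖iteratedDeriv 2 S t‖ + ‖iteratedDeriv 2 cc t‖ ≤ Q * (E₂ + E₁)) ∧ (E₁ ≤ 1 → E₂ ≤ 1 → ‖iteratedDeriv 3 S t‖ + ‖iteratedDeriv 3 cc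 t‖ ≤ Q * (E₃ + E₂ + E₁)) ∧ ‖A t‖ ≤ Q * E₁ ∧ (E₁ ≤ 1 → ‖deriv A t‖ ≤ Q * (E₂ + E₁)) ∧ (E₁ ≤ 1 → E₂ ≤ Q * ((‖deriv A t (E4.basisVector 0)‖ + ‖E4.spatial (S t (-(iteratedDeriv 2 cc t)))‖ + ‖a • deriv A t (E4.basisVector 3)‖) + E₁)) ∧ (E₁ ≤ 1 → E₂ ≤ 1 → E₃ ≤ Q * ((‖iteratedDeriv 2 A t (E4.basisVector 0)‖ + ‖E4.spatial (S t (-(iteratedDeriv 3 cc t)))‖ + ‖a • iteratedDeriv 2 A t (E4.basisVector 3)‖) + E₂ + E₁)) :=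
  fun Λ ξ a _ hΛ hξ hγ ↦ higherOrder_holePackage Λ ξ a hΛ hξ hγ

end Summit.FinalStateConjecture.FinalStateConjecture.Theorems.SublinearIsFree.Slaving

end
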